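import Literature.NumberTheory.EllipticCurves.InertiaInvariantsKodairaNeronAdditiveProofs
import Literature.NumberTheory.EllipticCurves.KodairaNeronUnramifiedAdditiveBoundProofs
import Literature.NumberTheory.EllipticCurves.AdditiveReductionRamifiedTorsionProofs
import Literature.NumberTheory.EllipticCurves.InertiaInvariantsAdditiveProofs
import Literature.NumberTheory.Automorphic.CDTTheorem722SerreLevelProofs
import HarnessLib

/-!
# Route `ErratumRoadFive` (K2), crux `NonSurjCorner` (item stmt-BirchSwinnertonDyer-19065), child `NonSurjCornerTwinMuAn` (19948):
# `E[p]^{I_v} = 0` AT AN ADDITIVE PLACE `v ∤ p`, `p ≥ 5`, AND THE SERRE EXPONENT `a_v(E[p] ⊗ k) = a_v(V_p E)`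
# (cell `bsd-stepL`, WIDTH-LEVER lane B `bsd-stepL-corner5-p2` g11; `--supports stmt-BirchSwinnertonDyer-19948 --as helper`)

WHAT. For an elliptic curve `E/K` over a number field, a prime `p ≥ 5` and a finite place `v ∤ p` of ADDITIVE reduction:

* §1 `torsion_eq_zero_of_inertia_fixed` — **no non-zero `p`-torsion point of `E(K̄)` is fixed by the inertia group `I_𝔓`**
  (`𝔓 ∣ v` a prime of `\bar ℤ_K`): the `I_𝔓`-fixed `p`-torsion injects into `E(K_v^nr)/E₀(K_v^nr)`, of order `c ≤ 4 < p`
  (the tree's Kodaira–Néron exponent `exists_nsmul_reducesToNonsingular_le_four_of_hasAdditiveReduction`, Silverman *AEC* VII.6.1),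
  because `E₀` has no prime-to-`char(v)` torsion at a cusp (`eq_zero_of_zsmul_eq_zero_of_cusp`, *ATAEC* IV.9 Rem. 9.2.2); hence
  `c • P = 0 = p • P` with `gcd(c, p) = 1`, so `P = 0`. (The tree had the case `p ≥ 3`: SOME `p`-torsion point is moved,
  `exists_smul_geomTorsion_ne_of_hasAdditiveReductionAt`; for `p ≥ 5` ALL are.) Corollaries: `E[p]^{I_𝔓} = ⊥`
  (`fixedSubmodule_inertia_torsionGaloisRep_eq_bot`) and `codim E[p]^{I_𝔓} = 2` (`codimFixed_inertia_torsionGaloisRep_eq_two`).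
* §2 `artinConductorExponent_baseChange_eq_of_hasAdditiveReductionAt` — **the Artin exponent of `E[p] ⊗ k` at `v` EQUALS that of
  `V_p E`** (the tree had `≤`, `IsTorsionGaloisRep.artinConductorExponent_baseChange_le`): both tame parts are `2` (§1 and the tree's
  *ATAEC* IV.10.2(a) `codimFixed_inertia_rationalTate_eq_two_of_hasAdditiveReductionAt_holds`), the Swan parts agree
  (`swanConductorAt_rationalTate_eq_swanConductorAt_torsion`). With Ogg–Saito this is `a_v(E[p] ⊗ k) = f_v(E)`: at the additive
  primes Serre's level `N(ρ̄_{E,p})` has the FULL conductor exponent (Kraus 1997, p. 1143; Carayol 1989 §1) — the input of the lane's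
  "Serre level = additive conductor" door (`ErratumRoadFiveNonSurjCornerSerreLevelExact`).

WHY (lane B, census by Serre level, HOME/corner5/g10–g11): the candidate corner classes at `p` live at weight-two newforms of level
EXACTLY `N_add(E) = ∏_{q additive} q^{f_q}` — a CONDUCTOR-SHAPED number (`f_q = 2` for `q ≥ 5`, `2 ≤ f_2 ≤ 8`, `2 ≤ f_3 ≤ 5`) — so the
level census need only visit those levels (75 of the 3 199 levels `≤ 4 000` prime to `5`). HONEST FRAMING: theorems about elliptic
curves over number fields, no named-fact hypothesis, no `sorry`, no new definition; items 19065 ∕ 19948 are NOT closed; BSD is proved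
for no curve. [cite: SilvermanAEC2009, Thm. VII.6.1 and proof of Thm. VII.7.1] [cite: SilvermanATAEC1994, Thm. IV.10.2(a), Rem. IV.9.2.2]
[cite: Kraus1997, p. 1143] [cite: Serre1987, §4.6, Lemme 5 (4.6.3)]
-/

set_option autoImplicit false
set_option linter.dupNamespace false

noncomputable section

open scoped Classical NNReal Pointwise NumberField
open NumberField IsDedekindDomain Field Module

universe u

namespace Summit.BirchSwinnertonDyer.BirchSwinnertonDyer.Theorems.NonSurjCornerSerreLevelExact

open WeierstrassCurve Literature.NumberTheory.EllipticCurves Literature.NumberTheory.GaloisRepresentations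
  IsDedekindDomain.HeightOneSpectrum

/-! ### §1 No inertia-fixed `p`-torsion at an additive place, `p ≥ 5` -/

section TorsionInertia

variable {K : Type u} [Field K] [NumberField K] (W : WeierstrassCurve K) {v : HeightOneSpectrum (𝓞 K)}

/-- **`E[p]^{I} = 0` at an additive `v ∤ p`, `p ≥ 5` — at the prime cut out by an embedding.** For `E/K` elliptic, `v` a finite
place of ADDITIVE reduction, `p ≥ 5` a prime with `v ∤ p`, a `K`-embedding `ι : K̄ → K̄_v` and the prime `𝔐` of `\bar 𝓞_v` above `𝓂_v`:
a point `P ∈ E(K̄)` with `p • P = O` fixed by the inertia group of `𝔓_{ι,𝔐}` is `O`. Proof: transported to the minimal model `X` at `v`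
(`exists_addEquiv_localPoints_of_smul_eq`, equivariant), `P` is `I_𝔐`-fixed, so `c • P ∈ E₀` for the Kodaira–Néron index `0 < c ≤ 4`
(`exists_nsmul_reducesToNonsingular_le_four_of_hasAdditiveReduction`); the reduction being a cusp and `|p|_v = 1`, a point of `E₀` killed
by `p` is `O` (`eq_zero_of_zsmul_eq_zero_of_cusp`); so `c • P = O = p • P` with `gcd(c, p) = 1` (`c ≤ 4 < 5 ≤ p`), whence `P = O`.
[cite: SilvermanAEC2009, Thm. VII.6.1 (PDF p. 177) and proof of Thm. VII.7.1 (PDF p. 179)] [cite: SilvermanATAEC1994, Rem. IV.9.2.2 (PDF p. 340)] -/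
theorem torsion_eq_zero_of_inertia_primeBelow_fixed [W.IsElliptic]
    (hadd : W.HasAdditiveReductionAt v) {p : ℕ} (hp : p.Prime) (hp5 : 5 ≤ p)
    (hpv : (p : 𝓞 K) ∉ v.asIdeal)
    (ι : AlgebraicClosure K →ₐ[K] AlgebraicClosure (v.adicCompletion K))
    {𝔐 : Ideal v.localAbsIntegers} (h𝔐 : 𝔐 ∈ v.localPrimesAbove)
    (P : geomPoints W)
    (hfix : ∀ σ ∈ (v.primeBelow ι 𝔐).inertia (absoluteGaloisGroup K), σ • P = P)
    (hpP : (p : ℤ) • P = 0) : P = 0 := by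
  obtain ⟨w, hw⟩ := v.exists_spectralValuation
  have hv0 : w.Integers w.integer := Valuation.integer.integers w
  haveI : (W.localMinimalModel v).IsElliptic := W.isElliptic_localMinimalModel v
  haveI : (W.localMinimalModel v).HasAdditiveReduction (v.adicCompletionIntegers K) := hadd
  -- a `w`-integral model `W₀` of the minimal model at `v`; its reduction is a cusp
  have hint : ((W.localMinimalModel v).baseChange (AlgebraicClosure (v.adicCompletion K))).IsIntegral
      w.integer := by
    have := isIntegral_spectralValuation_baseChange hw
      ((W.localMinimalModel v).integralModel (v.adicCompletionIntegers K))
    rwa [show ((W.localMinimalModel v).integralModel (v.adicCompletionIntegers K)).map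
        (algebraMap (v.adicCompletionIntegers K) (v.adicCompletion K)) = W.localMinimalModel v from
      baseChange_integralModel_eq (v.adicCompletionIntegers K) (W.localMinimalModel v)] at this
  obtain ⟨W₀, hW₀⟩ := hint.integral
  have hcoef : ∀ {a : v.adicCompletionIntegers K} (b : w.integer),
      algebraMap w.integer (AlgebraicClosure (v.adicCompletion K)) b =
        algebraMap (v.adicCompletion K) (AlgebraicClosure (v.adicCompletion K))
          (algebraMap (v.adicCompletionIntegers K) (v.adicCompletion K) a) →
      IsDedekindDomain.HeightOneSpectrum.valuation (v.adicCompletion K)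
          (IsDiscreteValuationRing.maximalIdeal (v.adicCompletionIntegers K))
          (algebraMap (v.adicCompletionIntegers K) (v.adicCompletion K) a) < 1 →
      IsLocalRing.residue w.integer b = 0 := by
    intro a b hab hlt
    have hmem : a ∈ IsLocalRing.maximalIdeal (v.adicCompletionIntegers K) :=
      (IsDedekindDomain.HeightOneSpectrum.valuation_lt_one_iff_mem _ a).mp hlt
    rw [← v_algebraMap_lt_one_iff hv0, hab]
    exact spectralValuation_algebraMap_lt_one_of_mem_maximalIdeal hw h𝔐 hmem
  have hΔ : IsLocalRing.residue w.integer W₀.Δ = 0 := by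
    refine hcoef (a := ((W.localMinimalModel v).integralModel (v.adicCompletionIntegers K)).Δ)
      W₀.Δ ?_ ?_
    · rw [integralModel_Δ_eq, ← map_Δ, ← map_Δ]
      change (W₀.baseChange (AlgebraicClosure (v.adicCompletion K))).Δ =
        ((W.localMinimalModel v).baseChange (AlgebraicClosure (v.adicCompletion K))).Δ
      rw [hW₀]
    · rw [integralModel_Δ_eq]; exact hadd.badReduction
  have hc₄ : IsLocalRing.residue w.integer W₀.c₄ = 0 := by
    refine hcoef (a := ((W.localMinimalModel v).integralModel (v.adicCompletionIntegers K)).c₄)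
      W₀.c₄ ?_ ?_
    · rw [integralModel_c₄_eq, ← map_c₄, ← map_c₄]
      change (W₀.baseChange (AlgebraicClosure (v.adicCompletion K))).c₄ =
        ((W.localMinimalModel v).baseChange (AlgebraicClosure (v.adicCompletion K))).c₄
      rw [hW₀]
    · rw [integralModel_c₄_eq]; exact hadd.additiveReduction
  -- equivariant transport of `E(K̄) → E(K̄_v)` to the minimal model, and the Kodaira–Néron exponent `c ≤ 4`
  obtain ⟨C, hC⟩ := W.exists_variableChange_smul_eq_localMinimalModel v
  obtain ⟨Φ, hΦ⟩ := W.exists_addEquiv_localPoints_of_smul_eq v hC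
  obtain ⟨c, hc0, hc4, hcE₀⟩ :=
    (W.localMinimalModel v).exists_nsmul_reducesToNonsingular_le_four_of_hasAdditiveReduction w hw h𝔐
  set Q := Φ (pointsMapOfEmb W ι P) with hQ
  have hfixloc : ∀ σ ∈ 𝔐.inertia (absoluteGaloisGroup (v.adicCompletion K)),
      Affine.Point.map ((absoluteGaloisGroup.toAlgEquiv _ σ :
          AlgebraicClosure (v.adicCompletion K) ≃ₐ[v.adicCompletion K]
            AlgebraicClosure (v.adicCompletion K)) :
          AlgebraicClosure (v.adicCompletion K) →ₐ[v.adicCompletion K]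
            AlgebraicClosure (v.adicCompletion K)) Q = Q := by
    intro σ hσ
    rw [hQ, ← hΦ σ, ← pointsMapOfEmb_smul, hfix _ (resGalOfEmb_mem_inertia_primeBelow v ι 𝔐 hσ)]
  have hns : W₀.HasNonsingularReduction (Affine.Point.congrEquiv hW₀ (c • Q)) :=
    (reducesToNonsingular_iff_hasNonsingularReduction W₀ _).mp
      ((reducesToNonsingular_congrEquiv_iff _ hW₀ _).mpr (hcE₀ Q hfixloc))
  -- `|p|_v = 1`, and `p` kills `c • Q`; so `c • Q = O` (cusp: `E₀` has no `p`-torsion)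
  have hpw : w ((p : ℤ) : AlgebraicClosure (v.adicCompletion K)) = 1 :=
    spectralValuation_intCast_eq_one hw (n := (p : ℤ)) (by simpa using hpv)
  have hpQ0 : (p : ℤ) • Q = 0 := by
    rw [hQ, ← map_zsmul, ← map_zsmul, hpP, map_zero, map_zero]
  have hpQ : (p : ℤ) • Affine.Point.congrEquiv hW₀ (c • Q) = 0 := by
    rw [← map_zsmul, ← natCast_zsmul, smul_smul, mul_comm, ← smul_smul, hpQ0, smul_zero, map_zero]
  have hcQ : Affine.Point.congrEquiv hW₀ (c • Q) = 0 :=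
    W₀.eq_zero_of_zsmul_eq_zero_of_cusp hΔ hc₄ hpw hns hpQ
  have hcP : (c : ℤ) • P = 0 := by
    apply pointsMapOfEmb_injective W ι
    apply Φ.injective
    apply (Affine.Point.congrEquiv hW₀).injective
    rw [map_zsmul, map_zsmul, natCast_zsmul, ← hQ, hcQ, map_zero, map_zero, map_zero]
  -- `gcd(c, p) = 1` since `0 < c ≤ 4 < 5 ≤ p`
  have hcop : IsCoprime (c : ℤ) (p : ℤ) := by
    rw [Nat.isCoprime_iff_coprime]
    exact (hp.coprime_iff_not_dvd.mpr (Nat.not_dvd_of_pos_of_lt hc0 (by omega))).symm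
  obtain ⟨a, b, hab⟩ := hcop
  calc P = (a * c + b * p) • P := by rw [hab, one_smul]
    _ = 0 := by rw [add_smul, mul_smul, mul_smul, hcP, hpP, smul_zero, smul_zero, add_zero]

/-- **`E[p]^{I_𝔓} = 0` at every prime `𝔓 ∣ v` of `\bar ℤ_K`, `v ∤ p` additive, `p ≥ 5`.** Every such prime is cut out by an embedding
(`Γ_K` is transitive on the primes above `v`, `exists_smul_eq_of_mem_primesAbove_holds`; `𝔓_{ι∘τ,𝔐} = τ⁻¹ • 𝔓_{ι,𝔐}`,
`primeBelow_comp`), so `torsion_eq_zero_of_inertia_primeBelow_fixed` applies.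
[cite: SilvermanAEC2009, Thm. VII.6.1 and proof of Thm. VII.7.1 (PDF pp. 177–179)] -/
theorem torsion_eq_zero_of_inertia_fixed [W.IsElliptic]
    (hadd : W.HasAdditiveReductionAt v) {p : ℕ} (hp : p.Prime) (hp5 : 5 ≤ p)
    (hpv : (p : 𝓞 K) ∉ v.asIdeal)
    {𝔓 : Ideal (absIntegers (𝓞 K) K)} (h𝔓 : 𝔓 ∈ v.primesAbove)
    (P : geomPoints W) (hfix : ∀ σ ∈ 𝔓.inertia (absoluteGaloisGroup K), σ • P = P)
    (hpP : (p : ℤ) • P = 0) : P = 0 := by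
  obtain ⟨𝔐, h𝔐⟩ := v.localPrimesAbove_nonempty
  obtain ⟨g, hg⟩ := HeightOneSpectrum.exists_smul_eq_of_mem_primesAbove_holds
    (HeightOneSpectrum.primeBelow_mem_primesAbove
      (ι := closureEmb (K := K) (v.adicCompletion K)) h𝔐) h𝔓
  have h1 : 𝔓 = v.primeBelow ((closureEmb (K := K) (v.adicCompletion K)).comp
      ((show AlgebraicClosure K ≃ₐ[K] AlgebraicClosure K from g⁻¹) :
        AlgebraicClosure K →ₐ[K] AlgebraicClosure K)) 𝔐 := by
    rw [HeightOneSpectrum.primeBelow_comp, ← hg]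
    exact congrArg (· • _) (inv_inv g).symm
  rw [h1] at hfix
  exact torsion_eq_zero_of_inertia_primeBelow_fixed W hadd hp hp5 hpv _ h𝔐 P hfix hpP

/-- **`E[p]^{I_𝔓} = ⊥`** for the mod-`p` representation `WeierstrassCurve.torsionGaloisRep` (fixed submodule of the inertia group),
at an additive `v ∤ p`, `p ≥ 5`, `𝔓 ∣ v` (the `ℤ/p`-module structure on `E[p]` is Mathlib's `AddSubgroup.torsionBy.zmodModule`, the one
carried by `torsionGaloisRep`, supplied inline rather than as a local instance). [cite: SilvermanAEC2009, Thm. VII.6.1 and proof of Thm. VII.7.1 (PDF pp. 177–179)] -/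
theorem fixedSubmodule_inertia_torsionGaloisRep_eq_bot [W.IsElliptic]
    (hadd : W.HasAdditiveReductionAt v) {p : ℕ} [Fact p.Prime] (hp5 : 5 ≤ p)
    (hpv : (p : 𝓞 K) ∉ v.asIdeal)
    {𝔓 : Ideal (absIntegers (𝓞 K) K)} (h𝔓 : 𝔓 ∈ v.primesAbove) :
    letI : Module (ZMod p) (geomTorsion W p) := AddSubgroup.torsionBy.zmodModule
    (W.torsionGaloisRep p).fixedSubmodule (𝔓.inertia (absoluteGaloisGroup K)) = ⊥ := by
  letI : Module (ZMod p) (geomTorsion W p) := AddSubgroup.torsionBy.zmodModule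
  rw [eq_bot_iff]
  intro P hP
  rw [Submodule.mem_bot]
  have hfix := (W.mem_fixedSubmodule_torsionGaloisRep_iff p _ P).mp hP
  have hpP : (p : ℤ) • (P : geomPoints W) = 0 := (mem_geomTorsion_iff _ _ _).mp P.2
  exact Subtype.ext (torsion_eq_zero_of_inertia_fixed W hadd Fact.out hp5 hpv h𝔓 _ hfix hpP)

/-- **`codim E[p]^{I_𝔓} = 2`** (Silverman *ATAEC* IV.10.2(a), additive case, READ ON THE `p`-TORSION for `p ≥ 5`): the tame part of
the Artin exponent of `E[p]` at an additive `v ∤ p` is `2`. [cite: SilvermanATAEC1994, Thm. IV.10.2(a) (PDF p. 358)]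
[cite: SilvermanAEC2009, Thm. VII.6.1] -/
theorem codimFixed_inertia_torsionGaloisRep_eq_two [W.IsElliptic]
    (hadd : W.HasAdditiveReductionAt v) {p : ℕ} [Fact p.Prime] (hp5 : 5 ≤ p)
    (hpv : (p : 𝓞 K) ∉ v.asIdeal)
    {𝔓 : Ideal (absIntegers (𝓞 K) K)} (h𝔓 : 𝔓 ∈ v.primesAbove) :
    letI : Module (ZMod p) (geomTorsion W p) := AddSubgroup.torsionBy.zmodModule
    (W.torsionGaloisRep p).codimFixed (𝔓.inertia (absoluteGaloisGroup K)) = 2 := by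
  letI : Module (ZMod p) (geomTorsion W p) := AddSubgroup.torsionBy.zmodModule
  have hprime : p.Prime := Fact.out
  have hp0 : (p : K) ≠ 0 := Nat.cast_ne_zero.mpr hprime.ne_zero
  haveI : Finite (geomTorsion W p) := W.finite_geomTorsion_nat hprime.ne_zero
  haveI : Module.Finite (ZMod p) (geomTorsion W p) := Module.Finite.of_finite
  rw [ContinuousRep.codimFixed_eq_finrank_sub, W.finrank_geomTorsion_eq_two p hp0,
    fixedSubmodule_inertia_torsionGaloisRep_eq_bot W hadd hp5 hpv h𝔓, finrank_bot]

end TorsionInertia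

/-! ### §2 The Serre exponent at an additive place: `a_v(E[p] ⊗ k) = a_v(V_p E)` -/

section Exponent

open MeasureTheory Literature.NumberTheory.Automorphic.BCDT

/-- **`a_v(ρ̄_{E,p} ⊗ k) = a_v(V_p E)` at an ADDITIVE place `v ∤ p`, `p ≥ 5`** (equality in the tree's
`IsTorsionGaloisRep.artinConductorExponent_baseChange_le`): for `E/K` elliptic, a framed model `ρ̄` of `E[p]`, `j : 𝔽_p → k`, the Artin
exponent `⌊codim M^{I_𝔓} + Sw_𝔓⌋₊` at the chosen `𝔓 ∣ v` is the same for `M = E[p] ⊗ k` and `M = V_p E`: the inertia terms are both `2`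
(`codimFixed_inertia_torsionGaloisRep_eq_two` after `codimFixed_toContinuousRep_baseChange` and `IsTorsionGaloisRep.codimFixed_toGaloisRep_eq`;
`codimFixed_inertia_rationalTate_eq_two_of_hasAdditiveReductionAt_holds`), the Swan terms agree
(`swanConductorAt_rationalTate_eq_swanConductorAt_torsion`). With Ogg–Saito (`a_v(V_p E) = f_v(E)`): the exponent of an additive prime in
Serre's level `N(ρ̄_{E,p})` is the full conductor exponent (Kraus). [cite: Kraus1997, p. 1143] [cite: Serre1987, §4.6, Lemme 5 (4.6.3)]
[cite: SilvermanATAEC1994, Thm. IV.10.2(a)] -/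
theorem artinConductorExponent_baseChange_eq_of_hasAdditiveReductionAt
    {K : Type u} [Field K] [NumberField K] {W : WeierstrassCurve K} [W.IsElliptic]
    {p : ℕ} [Fact p.Prime] (hp5 : 5 ≤ p) {ρ : FramedGaloisRep K (ZMod p) 2} (hρ : W.IsTorsionGaloisRep p ρ)
    {k : Type*} [Field k] [TopologicalSpace k] [IsTopologicalRing k]
    (j : ZMod p →+* k) (hj : Continuous j)
    (h : Continuous fun x : absoluteGaloisGroup K × RationalTateModule (geomPoints W) p ↦
      rationalTateRepresentation (absoluteGaloisGroup K) (geomPoints W) p x.1 x.2)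
    {v : HeightOneSpectrum (𝓞 K)} (hv : (p : 𝓞 K) ∉ v.asIdeal) (hadd : W.HasAdditiveReductionAt v) :
    (FramedGaloisRep.toGaloisRep (ρ.baseChange j hj)).artinConductorExponent v =
      conductorExponentOf (geomPoints W) p h v := by
  letI : Module (ZMod p) (geomTorsion W p) := AddSubgroup.torsionBy.zmodModule
  have hprime : p.Prime := Fact.out
  have hp0 : (p : K) ≠ 0 := Nat.cast_ne_zero.mpr hprime.ne_zero
  set 𝔓 := (HeightOneSpectrum.primesAbove_nonempty v).some with h𝔓def
  have h𝔓 : 𝔓 ∈ v.primesAbove := (HeightOneSpectrum.primesAbove_nonempty v).some_mem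
  have hcodim : ∀ H : Subgroup (absoluteGaloisGroup K),
      (FramedGaloisRep.toGaloisRep (ρ.baseChange j hj)).codimFixed H = (W.torsionGaloisRep p).codimFixed H :=
    fun H ↦ (codimFixed_toContinuousRep_baseChange ρ j hj H).trans (hρ.codimFixed_toGaloisRep_eq hp0 H)
  unfold conductorExponentOf GaloisRep.artinConductorExponent
  rw [← h𝔓def, GaloisRep.artinConductorAt_def, GaloisRep.artinConductorAt_def, hcodim,
    codimFixed_inertia_torsionGaloisRep_eq_two W hadd hp5 hv h𝔓,
    W.codimFixed_inertia_rationalTate_eq_two_of_hasAdditiveReductionAt_holds p h v hv hadd h𝔓,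
    W.swanConductorAt_rationalTate_eq_swanConductorAt_torsion p h hv h𝔓,
    GaloisRep.swanConductorAt_def, GaloisRep.swanConductorAt_def]
  congr 3
  funext u
  rw [hcodim]

end Exponent

end Summit.BirchSwinnertonDyer.BirchSwinnertonDyer.Theorems.NonSurjCornerSerreLevelExact

end
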